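import Summits.QuantumFields.YangMills.Theorems.UnitScaleTiltCoverSitesPush
import HarnessLib

/-!
# Route `UnitScaleTilt`, crux K1 child «MinimiserStabilityRegPr» (stmt-QuantumFields-19200), stub `stub_halvingStep` (H), residual «H-SMALL», route of record
# (b7) «COVER LIFT IN THE STATIONARITY CURRENCY» (★★OWNER RULINGS №29∕№30 (4)) — LIFT PACKAGE, FILE 3 input (i): **THE DECK-ORBIT SUM IS THE PUSH-FORWARD**
# `Σ_{τ ∈ Deck} g(τ x̃) = (π_* g)(π x̃)` on sites and bonds of the `L^{jc}`-fold cover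

Cell `ym3-torus` (HUMAN RULING D-0037: continuum `SU(2)` YM₃ on T³ is ladder rung R3 — not d = 4, not infinite volume, not a mass gap, not the Clay problem), extra width
seat `ym-ust-20520-w7` gen 0, piece (i) named by the lift-package holder ★`ym-ust-20520-w3` g5 (11:46:40Z).  `--supports stmt-QuantumFields-19200 --as helper`; DEF-FREE
(the deck translation by `c : Fin d → Fin (L^{jc})` is written INLINE in the letters of ★`ym-inputs-p06` g3's `…CoverDeckNaturality`:
`fun ν => x̃ ν + (((c ν : ℕ) * P.sitesPerDir i : ℕ) : ZMod ((cover P jc).sitesPerDir i))`); 0 sorry; standard axioms.  Nothing here claims the stub, the crux, the rung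
or the gap.

WHY.  FILE 3 of the lift package (★w3-20520 g5, `…CoverLiftTangent`: the push-forward of a cover constraint-tangent is a member constraint-tangent) averages a cover
tangent field `Ẏ` over the deck group and reads the result as the lift of the push-forward: `Σ_τ τ^* Ẏ = (π_* Ẏ) ∘ π`.  Pointwise this is the statement that the
deck orbit of a cover site `x̃` IS the fibre `π⁻¹(π x̃)`, enumerated ONCE by the translations `x̃ ↦ x̃ + c·N_i`, `c : Fin d → Fin (L^{jc})` (`N_i = 2L^{m+K−i}` the
member's site count, `Ñ_i = N_i·L^{jc}` the cover's, standing range `i ≤ m + K`).  The tree has the fibre COUNT (✓`CoverSites.card_fibre_site`, `(L^{jc})^d`) and the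
push-forward `π_*` as a fibre sum (✓`CoverSites.push`∕`pushBond`); this file supplies the enumeration and the two sum identities.

WHAT IS PROVED (no definition, no sorry; [folklore] finite combinatorics of the covering `(ℤ∕Ñ)^d → (ℤ∕N)^d`):
* §1 `val_deckCoord` (the canonical representative of `(c ν)·N_i` in `ZMod Ñ_i` is itself, `c ν < L^{jc}`), `proj_deck_fin` (`π(x̃ + c·N) = π x̃`),
  ★`deck_injective_of_fin` (`c ↦ x̃ + c·N` is injective on `Fin d → Fin (L^{jc})`), ★`image_deck_eq_fibre` (its image is the whole fibre `{ỹ | π ỹ = π x̃}`).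
* §2 ★★`sum_deck_site_eq_push_proj` (`Σ_c g(x̃ + c·N) = (π_* g)(π x̃)`), `pushBond_eq_push_src` (`(π_* g)⟨x, μ⟩ = (π_* g(⟨·, μ⟩))(x)`),
  ★★`sum_deck_bond_eq_pushBond_projBond` (`Σ_c g⟨b̃.src + c·N, b̃.dir⟩ = (π_* g)(π b̃)`).

References: T. Bałaban, CMP **109** (1987) 249–301 [Balaban1987RG1] ((0.1)–(0.3) pp.251–252: the tori `T^{(i)}` and their site counts); CMP **102** (1985) 277–309
[Balaban1985Variational] ((144) p.300, Thm 1 p.279 — the member∕cover bookkeeping this serves).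
-/

open scoped BigOperators

namespace Summit.QuantumFields.YangMills.Theorems.CoverDeckOrbitSum

open Literature.MathematicalPhysics.QuantumFieldTheory.Balaban1983to89
open Summit.QuantumFields.YangMills.Theorems.CoverSites

variable (P : Params) (jc : ℕ)

/-! ## §1 The deck translations by `c : Fin d → Fin (L^{jc})` enumerate each fibre exactly once -/

section Enumeration

variable {i : ℕ}

/-- the canonical representative of the deck coordinate `(c ν)·N_i` in `ZMod Ñ_i` is `(c ν)·N_i` itself (`(c ν)·N_i < L^{jc}·N_i = Ñ_i` for `i ≤ m + K`). [folklore] -/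
theorem val_deckCoord (hi : i ≤ P.m + P.K) (c : Fin P.d → Fin (P.L ^ jc)) (ν : Fin P.d) :
    ((((c ν : ℕ) * P.sitesPerDir i : ℕ) : ZMod ((cover P jc).sitesPerDir i))).val = (c ν : ℕ) * P.sitesPerDir i := by
  apply ZMod.val_natCast_of_lt
  rw [sitesPerDir_cover_eq P jc i hi, mul_comm (P.sitesPerDir i)]
  exact Nat.mul_lt_mul_of_pos_right (c ν).2 (Nat.pos_of_ne_zero (P.sitesPerDir_ne_zero i))

/-- `π(x̃ + c·N_i) = π x̃`: the deck translations act inside the fibres of the covering map. [cite: Balaban1987RG1, (0.1) p.251] -/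
theorem proj_deck_fin (c : Fin P.d → Fin (P.L ^ jc)) (x : Site (cover P jc) i) :
    proj P jc i (fun ν => x ν + (((c ν : ℕ) * P.sitesPerDir i : ℕ) : ZMod ((cover P jc).sitesPerDir i))) = proj P jc i x := by
  refine proj_add_ker P jc i x _ ?_
  funext ν
  apply ZMod.val_injective
  rw [val_proj, val_proj, ZMod.val_zero, Nat.zero_mod, ZMod.val_natCast, Nat.mod_mod_of_dvd _ (sitesPerDir_dvd P jc i), Nat.mul_mod_left]

/-- ★ **the deck translations of a site are pairwise distinct**: `c ↦ x̃ + c·N_i` is injective on `Fin d → Fin (L^{jc})` (`i ≤ m + K`). [folklore] -/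
theorem deck_injective_of_fin (hi : i ≤ P.m + P.K) (x : Site (cover P jc) i) :
    Function.Injective (fun c : Fin P.d → Fin (P.L ^ jc) =>
      (fun ν => x ν + (((c ν : ℕ) * P.sitesPerDir i : ℕ) : ZMod ((cover P jc).sitesPerDir i))) : (Fin P.d → Fin (P.L ^ jc)) → Site (cover P jc) i) := by
  intro c c' h
  funext ν
  have hν := congrFun h ν
  have h1 : (((c ν : ℕ) * P.sitesPerDir i : ℕ) : ZMod ((cover P jc).sitesPerDir i))
      = (((c' ν : ℕ) * P.sitesPerDir i : ℕ) : ZMod ((cover P jc).sitesPerDir i)) := add_left_cancel hν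
  have h2 := congrArg ZMod.val h1
  rw [val_deckCoord P jc hi c ν, val_deckCoord P jc hi c' ν] at h2
  exact Fin.ext (Nat.eq_of_mul_eq_mul_right (Nat.pos_of_ne_zero (P.sitesPerDir_ne_zero i)) h2)

/-- ★ **THE DECK ORBIT OF A SITE IS ITS FIBRE**: the image of `c ↦ x̃ + c·N_i` (`c : Fin d → Fin (L^{jc})`) is exactly `{ỹ | π ỹ = π x̃}` (`i ≤ m + K`): it lies in the fibre
(`proj_deck_fin`), has `(L^{jc})^d` elements (`deck_injective_of_fin`), and the fibre has `(L^{jc})^d` elements (✓`CoverSites.card_fibre_site`). [cite: Balaban1987RG1, (0.1) p.251] -/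
theorem image_deck_eq_fibre (hi : i ≤ P.m + P.K) (x : Site (cover P jc) i) :
    Finset.image (β := Site (cover P jc) i)
        (fun c : Fin P.d → Fin (P.L ^ jc) => fun ν => x ν + (((c ν : ℕ) * P.sitesPerDir i : ℕ) : ZMod ((cover P jc).sitesPerDir i))) Finset.univ
      = Finset.univ.filter (fun y : Site (cover P jc) i => proj P jc i y = proj P jc i x) := by
  apply Finset.eq_of_subset_of_card_le
  · intro y hy
    obtain ⟨c, -, rfl⟩ := Finset.mem_image.mp hy
    rw [Finset.mem_filter]
    exact ⟨Finset.mem_univ _, proj_deck_fin P jc c x⟩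
  · have hc := Finset.card_image_of_injective (Finset.univ : Finset (Fin P.d → Fin (P.L ^ jc))) (deck_injective_of_fin P jc hi x)
    rw [Finset.card_univ, Fintype.card_pi, Finset.prod_const, Fintype.card_fin, Finset.card_univ, Fintype.card_fin] at hc
    rw [card_fibre_site P jc i hi]
    exact le_of_eq hc.symm

end Enumeration

/-! ## §2 The deck-orbit sum is the push-forward -/

section Sums

variable {i : ℕ} {M : Type*} [AddCommMonoid M]

/-- ★★ **THE DECK-ORBIT SUM OF A SITE FUNCTION IS ITS PUSH-FORWARD**: `Σ_{c : Fin d → Fin (L^{jc})} g(x̃ + c·N_i) = (π_* g)(π x̃)` (`i ≤ m + K`). [cite: Balaban1987RG1, (0.1) p.251] -/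
theorem sum_deck_site_eq_push_proj (hi : i ≤ P.m + P.K) (g : Site (cover P jc) i → M) (x : Site (cover P jc) i) :
    ∑ c : Fin P.d → Fin (P.L ^ jc), g (fun ν => x ν + (((c ν : ℕ) * P.sitesPerDir i : ℕ) : ZMod ((cover P jc).sitesPerDir i)))
      = push P jc i g (proj P jc i x) := by
  rw [push_apply, ← image_deck_eq_fibre P jc hi x]
  exact (Finset.sum_image fun c _ c' _ h => deck_injective_of_fin P jc hi x h).symm

/-- the bond push-forward is the site push-forward of the source, direction carried along: `(π_* g)⟨x, μ⟩ = (π_* (ỹ ↦ g⟨ỹ, μ⟩))(x)`. [folklore] -/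
theorem pushBond_eq_push_src [DecidableEq (PBond P i)] (g : PBond (cover P jc) i → M) (x : Site P i) (μ : Fin P.d) :
    pushBond P jc i g ⟨x, μ⟩ = push P jc i (fun y : Site (cover P jc) i => g ⟨y, μ⟩) x := by
  rw [pushBond_apply, push_apply]
  symm
  refine Finset.sum_nbij' (fun y : Site (cover P jc) i => (⟨y, μ⟩ : PBond (cover P jc) i)) (fun bt : PBond (cover P jc) i => bt.src) ?_ ?_ ?_ ?_ ?_
  · intro y hy
    simp only [Finset.mem_filter, Finset.mem_univ, true_and] at hy ⊢
    rw [projBond, hy]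
  · intro bt hbt
    simp only [Finset.mem_filter, Finset.mem_univ, true_and] at hbt ⊢
    exact congrArg PBond.src hbt
  · intro y _; rfl
  · rintro ⟨y, ν⟩ hbt
    simp only [Finset.mem_filter, Finset.mem_univ, true_and] at hbt
    have hν : ν = μ := congrArg PBond.dir hbt
    subst hν
    rfl
  · intro y _; rfl

/-- ★★ **THE DECK-ORBIT SUM OF A BOND FUNCTION IS ITS PUSH-FORWARD**: `Σ_{c : Fin d → Fin (L^{jc})} g⟨b̃.src + c·N_i, b̃.dir⟩ = (π_* g)(π b̃)` (`i ≤ m + K`) — pointwise form of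
`Σ_{τ ∈ Deck} τ^* g = (π_* g) ∘ π` for bond (tangent) fields on the cover. [cite: Balaban1987RG1, (0.1) p.251; Balaban1985Variational, (144) p.300] -/
theorem sum_deck_bond_eq_pushBond_projBond (hi : i ≤ P.m + P.K) [DecidableEq (PBond P i)] (g : PBond (cover P jc) i → M) (bt : PBond (cover P jc) i) :
    ∑ c : Fin P.d → Fin (P.L ^ jc),
        g ⟨fun ν => bt.src ν + (((c ν : ℕ) * P.sitesPerDir i : ℕ) : ZMod ((cover P jc).sitesPerDir i)), bt.dir⟩
      = pushBond P jc i g (projBond P jc i bt) := by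
  rw [projBond, pushBond_eq_push_src, ← sum_deck_site_eq_push_proj P jc hi (fun y : Site (cover P jc) i => g ⟨y, bt.dir⟩) bt.src]

end Sums

end Summit.QuantumFields.YangMills.Theorems.CoverDeckOrbitSum
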